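import Summits.BirchSwinnertonDyer.BirchSwinnertonDyer.Theorems.AdditiveKolyvaginRoadManinFrameOfCDT
import Summits.BirchSwinnertonDyer.BirchSwinnertonDyer.Theorems.EdixhovenFibreFiveSevenTwistDegreeStepFiveSeven
import HarnessLib

/-!
# Route `EdixhovenFibreFiveSeven`, crux TDS57 `TwistDegreeStepFiveSeven` (stmt-BirchSwinnertonDyer-22227) BY NAME,
# MODULO THE PRINTED CALEGARI–DIMITROV–TANG UNBOUNDED-DENOMINATORS THEOREM ONLY — `--supports`

Cell `pub/bsd-wall`, seat `bsd-line-edix-p1` g36 (LEAD lineage of the line `kato-lever`; the route is DORMANT, no seat holds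
the item). ONE conditional theorem (no definition, no named fact, no instance, no `sorry`); nothing is closed by name; BSD is
not proved; Manin's conjecture is not proved; no Manin theorem is announced.

WHAT. The sibling seat `bsd-line-ttd-p1` g31 landed `EdixhovenFibreFiveSevenOfCDT.starredOptimalManinUnitFiveSeven_of_CDT`
(K★ 22226 ⟸ CDT) and `kpResidueManinUnitFiveSeven_of_CDT_of_modularity` (KP57 23810 ⟸ CDT ∧ modularity), and recorded the
twist-DEGREE cruxes TDS57 / TDS11 as «NOT derived». TDS57 is derived here, by the same two steps as the P1-bar closer
`PotGoodManinUnitOfSL2NeronValuesBar.twistDegreeStepFiveSeven_of_sl2NeronValuesBar` (edix-p4 g31, p805274) with the Manin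
input swapped: (1) `AdditiveKolyOfCDT.exists_datum_not_dvd_c_of_CDT` (p769664) — GRANTED CDT and modularity, every globally
minimal `V` additive at `p ≥ 5` with `E[p]` irreducible has a conductor-level datum `D` with `p ∤ c(D)` (optimal member +
`TeichmullerTwistDescent.not_dvd_c_of_CDT` + prime-to-`p` transport); (2) `TwistDegreeStepFiveSeven.twistDegreeStep57_of_not_dvd_c`
(edix-p2) — such a `D` beats every conductor-level datum `D♭` of the `p*`-twist `W♭` in `v_p(deg ·)` (the twist identity
`v_p(deg D♭) + 2 v_p(c(D)) = v_p(deg D) + 2 v_p(c(D♭)) + 1`, Edixhoven 1991 §4 / Zagier 1985 §1). Modularity is TDS57's own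
first binder, so the ONLY external input is CDT.

* `twistDegreeStepFiveSeven_of_CDT : CalegariDimitrovTang2025_unboundedDenominators_algInt → TwistDegreeStepFiveSeven`.

HONEST STATUS: CONDITIONAL on the cite-only printed fact `Literature.NumberTheory.Automorphic.CalegariDimitrovTang2025_unboundedDenominators_algInt`
(Calegari–Dimitrov–Tang, J. Amer. Math. Soc. 38 (2025), Thm. 1, Remarks 58–59; vendored over Mathlib's `ModularForm`); TDS57 stays
OPEN by name (it now has two independent single-fact conditional closers: P1-bar (Kato 2004) and CDT). BSD is not proved by this.
[cite: CalegariDimitrovTang2025, Thm. 1 and Remarks 58–59] [cite: EdixhovenManin1991, §4 (cases 1/2)] [cite: ZagierCMB1985, §1 (p. 374)]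
-/

set_option autoImplicit false
-- the Theorems namespace of a single-conjunct summit repeats the summit name by design (D-0017)
set_option linter.dupNamespace false

noncomputable section

open scoped Classical

open WeierstrassCurve Literature.NumberTheory.EllipticCurves Literature.NumberTheory.EllipticCurves.ModularForms
  Literature.NumberTheory.EllipticCurves.Rank1Residual
  Summit.BirchSwinnertonDyer.BirchSwinnertonDyer.Theses.EdixhovenFibreFiveSeven
  Summit.BirchSwinnertonDyer.BirchSwinnertonDyer.Theorems

namespace Summit.BirchSwinnertonDyer.BirchSwinnertonDyer.Theorems.TwistDegreeStepsOfCDT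

/-- ★★★ **TDS57 `TwistDegreeStepFiveSeven` (stmt-BirchSwinnertonDyer-22227) GRANTED ONLY the printed CDT fact** (modularity is the
item's own first binder): for `p ∈ {5, 7}`, `V/ℚ` globally minimal, additive at `p` with `E[p]` irreducible (the «no `Iₙ*`» and
`ord_p Δ_min ≤ 4` clauses are used only by the twist identity), and `W♭` a globally minimal model of `V ⊗ χ_{p*}`: the conductor-level
datum `D` of `V` with `p ∤ c(D)` supplied by `AdditiveKolyOfCDT.exists_datum_not_dvd_c_of_CDT` has `v_p(deg D) < v_p(deg D♭)` for every
conductor-level datum `D♭` of `W♭` (`TwistDegreeStepFiveSeven.twistDegreeStep57_of_not_dvd_c`). CONDITIONAL on `hCDT`; the item is not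
closed by this; BSD is not proved by this. [cite: CalegariDimitrovTang2025, Thm. 1 and Remarks 58–59] [cite: EdixhovenManin1991, §4 (cases 1/2)] -/
theorem twistDegreeStepFiveSeven_of_CDT
    (hCDT : Literature.NumberTheory.Automorphic.CalegariDimitrovTang2025_unboundedDenominators_algInt) :
    TwistDegreeStepFiveSeven := by
  intro hnf p _ V _ _ _ Wf _ _ _ C hp57 hadd hirr hK hV4 hC
  have hp5 : 5 ≤ p := by rcases hp57 with rfl | rfl <;> omega
  obtain ⟨D, hc⟩ := AdditiveKolyOfCDT.exists_datum_not_dvd_c_of_CDT hCDT hnf V p hp5 hadd hirr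
  exact ⟨D, TwistDegreeStepFiveSeven.twistDegreeStep57_of_not_dvd_c hp5 V Wf hadd hK hV4 C hC D hc⟩

end Summit.BirchSwinnertonDyer.BirchSwinnertonDyer.Theorems.TwistDegreeStepsOfCDT

end
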